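import Summits.Langlands.Langlands.Theses.HeptagonalTower

/-!
# `TorsionSeven` is false without the cyclotomic-embedding hypothesis

Negative lemma (load-bearing analysis) for the crux `TorsionSeven` (stmt-Langlands-16989,
route-Langlands-HeptagonalTower).  Dropping the hypothesis
`∃ n, Nonempty (K →+* CyclotomicField (7 ^ (n + 1)) ℚ)` — keeping `K` a totally real number
field — makes the statement FALSE.

Witness: the totally real quadratic field `K = ℚ(√5)`, realised as the maximal real subfield of
`ℚ(ζ₅) = CyclotomicField 5 ℚ` with `√5 = 2ζ₅ + 2ζ₅⁴ + 1`, and the point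
`Q = (50 + 30√5, 750 + 330√5)` of the Legendre model `y² = x³ + 41x² + 400x = x(x+16)(x+25)` of
`X₀(15)` (the route file's literal `⟨0, 41, 0, 400, 0⟩`, base-changed to `K`): the tangent at `Q`
has slope `6 + 5√5`, `2Q = (20, 180)`, `4Q = (0, 0)`, `8Q = O`, so `Q` is a `K`-rational torsion
point (of order `8`) which is none of the eight rational torsion points.  (Halving criterion
behind it: for `P = (20, 180)` the three numbers `x(P) - eᵢ = 20, 36, 45` (`eᵢ = 0, -16, -25`) are
all squares in `ℚ(√5)`.)  Moral for provers: any proof of `TorsionSeven` must use the embedding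
hypothesis, and what it really uses is the ODD degree `[K:ℚ] ∣ 3·7ⁿ`: the `2`-primary torsion of
`X₀(15)` grows exactly over fields containing `√5` or `√-1`. [folklore]

The curve is spelled out everywhere as the route file's literal base-changed to `K`
(`((⟨0, 41, 0, 400, 0⟩ : WeierstrassCurve ℚ).baseChange K).toAffine`); no auxiliary definition.
-/

set_option linter.dupNamespace false -- project-wide: `Summit.Langlands.Langlands` is the mandated namespace

namespace Summit.Langlands.Langlands.Theorems.TorsionSeven.Negative

open WeierstrassCurve WeierstrassCurve.Affine WeierstrassCurve.Affine.Point
open scoped Classical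

section generic

variable {K : Type*} [Field K] [CharZero K]

/-- Coefficient `a₁ = 0` of the base-changed Legendre model (cast of the literal). [folklore] -/
theorem legendre_a₁ :
    ((⟨0, 41, 0, 400, 0⟩ : WeierstrassCurve ℚ).baseChange K).toAffine.a₁ = 0 := by simp

/-- Coefficient `a₂ = 41` of the base-changed Legendre model (cast of the literal). [folklore] -/
theorem legendre_a₂ :
    ((⟨0, 41, 0, 400, 0⟩ : WeierstrassCurve ℚ).baseChange K).toAffine.a₂ = 41 := by simp

/-- Coefficient `a₃ = 0` of the base-changed Legendre model (cast of the literal). [folklore] -/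
theorem legendre_a₃ :
    ((⟨0, 41, 0, 400, 0⟩ : WeierstrassCurve ℚ).baseChange K).toAffine.a₃ = 0 := by simp

/-- Coefficient `a₄ = 400` of the base-changed Legendre model (cast of the literal). [folklore] -/
theorem legendre_a₄ :
    ((⟨0, 41, 0, 400, 0⟩ : WeierstrassCurve ℚ).baseChange K).toAffine.a₄ = 400 := by simp

/-- Coefficient `a₆ = 0` of the base-changed Legendre model (cast of the literal). [folklore] -/
theorem legendre_a₆ :
    ((⟨0, 41, 0, 400, 0⟩ : WeierstrassCurve ℚ).baseChange K).toAffine.a₆ = 0 := by simp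

/-- If `s² = 5` then `b·s + a ≠ 0` whenever `(a/b)² ≠ 5` (`√5` is not the rational `-a/b`).
[folklore] -/
theorem aux_ne_zero {s : K} (hs : s ^ 2 = 5) {a b : K} (hb : b ≠ 0) (hab : (a / b) ^ 2 ≠ 5)
    (h : b * s + a = 0) : False := by
  have h' : s = -(a / b) := by field_simp; linear_combination h
  rw [h'] at hs
  exact hab (by linear_combination hs)

/-- `Q = (50 + 30√5, 750 + 330√5)` lies on the Legendre model of `X₀(15)`. [folklore] -/
theorem nonsingular_Q {s : K} (hs : s ^ 2 = 5) :
    ((⟨0, 41, 0, 400, 0⟩ : WeierstrassCurve ℚ).baseChange K).toAffine.Nonsingular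
      (50 + 30 * s) (750 + 330 * s) := by
  rw [nonsingular_iff', equation_iff]
  simp only [legendre_a₁, legendre_a₂, legendre_a₃, legendre_a₄, legendre_a₆]
  refine ⟨by linear_combination (-63000 - 27000 * s) * hs, Or.inr ?_⟩
  intro h
  exact aux_ne_zero hs (a := 1500) (b := 660) (by norm_num) (by norm_num) (by linear_combination h)

/-- `(20, 180)` lies on the Legendre model of `X₀(15)` (a rational point of order `4`). [folklore] -/
theorem nonsingular_P₄ :
    ((⟨0, 41, 0, 400, 0⟩ : WeierstrassCurve ℚ).baseChange K).toAffine.Nonsingular (20 : K) 180 := by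
  rw [nonsingular_iff', equation_iff]
  simp only [legendre_a₁, legendre_a₂, legendre_a₃, legendre_a₄, legendre_a₆]
  norm_num

/-- `(0, 0)` lies on the Legendre model of `X₀(15)` (a rational point of order `2`). [folklore] -/
theorem nonsingular_P₂ :
    ((⟨0, 41, 0, 400, 0⟩ : WeierstrassCurve ℚ).baseChange K).toAffine.Nonsingular (0 : K) 0 := by
  rw [nonsingular_zero]
  simp only [legendre_a₃, legendre_a₄, legendre_a₆]
  norm_num

/-- Doubling: `2 · (50 + 30√5, 750 + 330√5) = (20, 180)` (tangent slope `6 + 5√5`). [folklore] -/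
theorem Q_add_Q {s : K} (hs : s ^ 2 = 5) :
    (.some _ _ (nonsingular_Q hs) :
        ((⟨0, 41, 0, 400, 0⟩ : WeierstrassCurve ℚ).baseChange K).toAffine.Point) +
      .some _ _ (nonsingular_Q hs) = .some 20 180 nonsingular_P₄ := by
  have hy : (750 + 330 * s : K) ≠
      ((⟨0, 41, 0, 400, 0⟩ : WeierstrassCurve ℚ).baseChange K).toAffine.negY
        (50 + 30 * s) (750 + 330 * s) := by
    simp only [negY, legendre_a₁, legendre_a₃]
    intro h
    exact aux_ne_zero hs (a := 1500) (b := 660) (by norm_num) (by norm_num) (by linear_combination h)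
  have hsl : ((⟨0, 41, 0, 400, 0⟩ : WeierstrassCurve ℚ).baseChange K).toAffine.slope
      (50 + 30 * s) (50 + 30 * s) (750 + 330 * s) (750 + 330 * s) = 6 + 5 * s := by
    rw [slope_of_Y_ne rfl hy]
    simp only [negY, legendre_a₁, legendre_a₂, legendre_a₃, legendre_a₄]
    have hden : (750 + 330 * s - (-(750 + 330 * s) - 0 * (50 + 30 * s) - 0) : K) ≠ 0 := by
      intro h
      exact aux_ne_zero hs (a := 1500) (b := 660) (by norm_num) (by norm_num)
        (by linear_combination h)
    rw [div_eq_iff hden]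
    linear_combination (-600) * hs
  rw [add_self_of_Y_ne hy]
  simp only [some.injEq]
  rw [hsl]
  simp only [addX, addY, negAddY, negY, legendre_a₁, legendre_a₂, legendre_a₃]
  constructor
  · linear_combination 25 * hs
  · linear_combination (-125 * s) * hs

/-- Doubling: `2 · (20, 180) = (0, 0)` (tangent slope `9`). [folklore] -/
theorem P₄_add_P₄ :
    (.some (20 : K) 180 nonsingular_P₄ :
        ((⟨0, 41, 0, 400, 0⟩ : WeierstrassCurve ℚ).baseChange K).toAffine.Point) +
      .some (20 : K) 180 nonsingular_P₄ = .some 0 0 nonsingular_P₂ := by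
  have hy : (180 : K) ≠
      ((⟨0, 41, 0, 400, 0⟩ : WeierstrassCurve ℚ).baseChange K).toAffine.negY 20 180 := by
    simp only [negY, legendre_a₁, legendre_a₃]; norm_num
  rw [add_self_of_Y_ne hy]
  simp only [some.injEq]
  rw [slope_of_Y_ne rfl hy]
  simp only [addX, addY, negAddY, negY, legendre_a₁, legendre_a₂, legendre_a₃, legendre_a₄]
  norm_num

/-- `(0, 0)` has order `2`. [folklore] -/
theorem P₂_add_P₂ :
    (.some (0 : K) 0 nonsingular_P₂ :
        ((⟨0, 41, 0, 400, 0⟩ : WeierstrassCurve ℚ).baseChange K).toAffine.Point) +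
      .some (0 : K) 0 nonsingular_P₂ = 0 :=
  add_of_Y_eq rfl (by simp only [negY, legendre_a₁, legendre_a₃]; norm_num)

/-- `Q = (50 + 30√5, 750 + 330√5)` is a torsion point (`8Q = O`). [folklore] -/
theorem isOfFinAddOrder_Q {s : K} (hs : s ^ 2 = 5) :
    IsOfFinAddOrder (.some _ _ (nonsingular_Q hs) :
      ((⟨0, 41, 0, 400, 0⟩ : WeierstrassCurve ℚ).baseChange K).toAffine.Point) := by
  rw [isOfFinAddOrder_iff_nsmul_eq_zero]
  refine ⟨8, by norm_num, ?_⟩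
  have h2 : (2 : ℕ) • (.some _ _ (nonsingular_Q hs) :
      ((⟨0, 41, 0, 400, 0⟩ : WeierstrassCurve ℚ).baseChange K).toAffine.Point) =
        .some 20 180 nonsingular_P₄ := by
    rw [two_nsmul, Q_add_Q hs]
  have h4 : (2 : ℕ) • (.some 20 180 nonsingular_P₄ :
      ((⟨0, 41, 0, 400, 0⟩ : WeierstrassCurve ℚ).baseChange K).toAffine.Point) =
        .some 0 0 nonsingular_P₂ := by
    rw [two_nsmul, P₄_add_P₄]
  have h8 : (2 : ℕ) • (.some 0 0 nonsingular_P₂ :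
      ((⟨0, 41, 0, 400, 0⟩ : WeierstrassCurve ℚ).baseChange K).toAffine.Point) = 0 := by
    rw [two_nsmul, P₂_add_P₂]
  rw [show (8 : ℕ) = 2 * (2 * 2) from rfl, ← smul_smul, ← smul_smul, h2, h4, h8]

/-- `Q` is none of the eight rational torsion points (its `x`-coordinate is irrational). [folklore] -/
theorem Q_not_listed {s : K} (hs : s ^ 2 = 5) :
    ¬ ((50 + 30 * s = (0 : K) ∧ 750 + 330 * s = (0 : K)) ∨
       (50 + 30 * s = (-16 : K) ∧ 750 + 330 * s = (0 : K)) ∨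
       (50 + 30 * s = (-25 : K) ∧ 750 + 330 * s = (0 : K)) ∨
       (50 + 30 * s = (20 : K) ∧ 750 + 330 * s = (180 : K)) ∨
       (50 + 30 * s = (20 : K) ∧ 750 + 330 * s = (-180 : K)) ∨
       (50 + 30 * s = (-20 : K) ∧ 750 + 330 * s = (20 : K)) ∨
       (50 + 30 * s = (-20 : K) ∧ 750 + 330 * s = (-20 : K))) := by
  rintro (⟨h, -⟩ | ⟨h, -⟩ | ⟨h, -⟩ | ⟨h, -⟩ | ⟨h, -⟩ | ⟨h, -⟩ | ⟨h, -⟩)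
  · exact aux_ne_zero hs (a := 50) (b := 30) (by norm_num) (by norm_num) (by linear_combination h)
  · exact aux_ne_zero hs (a := 66) (b := 30) (by norm_num) (by norm_num) (by linear_combination h)
  · exact aux_ne_zero hs (a := 75) (b := 30) (by norm_num) (by norm_num) (by linear_combination h)
  · exact aux_ne_zero hs (a := 30) (b := 30) (by norm_num) (by norm_num) (by linear_combination h)
  · exact aux_ne_zero hs (a := 30) (b := 30) (by norm_num) (by norm_num) (by linear_combination h)
  · exact aux_ne_zero hs (a := 70) (b := 30) (by norm_num) (by norm_num) (by linear_combination h)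
  · exact aux_ne_zero hs (a := 70) (b := 30) (by norm_num) (by norm_num) (by linear_combination h)

end generic

section sqrtFive

open NumberField

/-- `(2ζ + 2ζ⁴ + 1)² = 5` for a primitive fifth root of unity `ζ` (Gauss sum of conductor `5`).
[folklore] -/
theorem gauss_sum_sq {L : Type*} [Field L] {ζ : L} (hζ : IsPrimitiveRoot ζ 5) :
    (2 * ζ + 2 * ζ ^ 4 + 1) ^ 2 = 5 := by
  have h5 : ζ ^ 5 = 1 := hζ.pow_eq_one
  have hsum : 1 + ζ + ζ ^ 2 + ζ ^ 3 + ζ ^ 4 = 0 := by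
    have := hζ.geom_sum_eq_zero (by norm_num : 1 < 5)
    simpa [Finset.sum_range_succ] using this
  linear_combination (4 * ζ ^ 3 + 8) * h5 + 4 * hsum

/-- `2ζ₅ + 2ζ₅⁴ + 1 = 2ζ₅ + 2ζ₅⁻¹ + 1` is fixed by complex conjugation under every embedding, i.e. it
lies in the maximal real subfield. [folklore] -/
theorem gauss_sum_mem_maximalRealSubfield {L : Type*} [Field L] [CharZero L] {ζ : L}
    (hζ : IsPrimitiveRoot ζ 5) : 2 * ζ + 2 * ζ ^ 4 + 1 ∈ maximalRealSubfield L := by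
  rw [mem_maximalRealSubfield_iff]
  intro φ
  have h5 : (φ ζ) ^ 5 = 1 := by rw [← map_pow, hζ.pow_eq_one, map_one]
  have hnorm : ‖φ ζ‖ = 1 := Complex.norm_eq_one_of_pow_eq_one h5 (by norm_num)
  have hconj : (starRingEnd ℂ) (φ ζ) = (φ ζ) ^ 4 := by
    rw [← Complex.inv_eq_conj hnorm]
    exact (eq_inv_of_mul_eq_one_left (by linear_combination h5)).symm
  rw [← starRingEnd_apply]
  simp only [map_add, map_mul, map_pow, map_one, map_ofNat, hconj]
  linear_combination (2 * φ ζ * ((φ ζ) ^ 10 + (φ ζ) ^ 5 + 1)) * h5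

end sqrtFive

open NumberField in
/-- **`TorsionSeven` minus the embedding hypothesis is false** (`_false_without_` lemma): there is a
totally real number field `K` (namely `ℚ(√5)`, the maximal real subfield of `ℚ(ζ₅)`) and a torsion
`K`-point of the Legendre model of `X₀(15)` — `Q = (50 + 30√5, 750 + 330√5)`, of order `8` — outside
the list of the eight rational torsion points.  Hence the hypothesis
`∃ n, Nonempty (K →+* CyclotomicField (7 ^ (n + 1)) ℚ)` of
`Summit.Langlands.Langlands.Theses.HeptagonalTower.TorsionSeven` is load-bearing (through the odd
degree `[K:ℚ]`).  The negated statement below is the route decl verbatim with that one hypothesis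
deleted. [folklore] -/
theorem torsionSeven_false_without_emb :
    ¬ (∀ (K : Type) [Field K] [NumberField K], NumberField.IsTotallyReal K →
        ∀ (x y : K) (h : (({ a₁ := 0, a₂ := 41, a₃ := 0, a₄ := 400, a₆ := 0 } :
          WeierstrassCurve ℚ).baseChange K).toAffine.Nonsingular x y),
          IsOfFinAddOrder (WeierstrassCurve.Affine.Point.some x y h) →
            (x = 0 ∧ y = 0) ∨ (x = -16 ∧ y = 0) ∨ (x = -25 ∧ y = 0) ∨ (x = 20 ∧ y = 180) ∨
              (x = 20 ∧ y = -180) ∨ (x = -20 ∧ y = 20) ∨ (x = -20 ∧ y = -20)) := by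
  intro H
  -- the instance is not found by synthesis (ℚ-algebra diamond on the splitting field); name it
  haveI hcyc : IsCyclotomicExtension {(5 : ℕ)} ℚ (CyclotomicField 5 ℚ) :=
    CyclotomicField.isCyclotomicExtension 5 ℚ
  have hζ : IsPrimitiveRoot (IsCyclotomicExtension.zeta 5 ℚ (CyclotomicField 5 ℚ)) 5 :=
    IsCyclotomicExtension.zeta_spec 5 ℚ (CyclotomicField 5 ℚ)
  let s : ↥(maximalRealSubfield (CyclotomicField 5 ℚ)) :=
    ⟨_, gauss_sum_mem_maximalRealSubfield hζ⟩
  have hs : s ^ 2 = 5 := by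
    apply Subtype.ext
    push_cast
    exact gauss_sum_sq hζ
  exact Q_not_listed hs (H (↥(maximalRealSubfield (CyclotomicField 5 ℚ))) inferInstance
    (50 + 30 * s) (750 + 330 * s) (nonsingular_Q hs) (isOfFinAddOrder_Q hs))

end Summit.Langlands.Langlands.Theorems.TorsionSeven.Negative
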